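import Summits.AtomisticToContinuum.FouriersLaw.Theorems.HonestZwanzigNetworkReductionBilinear
import Summits.AtomisticToContinuum.FouriersLaw.Theorems.HonestZwanzigNetworkReductionCircuit

/-!
# HonestZwanzig / NetworkReduction — the fixed-`N`, fixed-`s` package and sandwich

Support file for item `stmt-AtomisticToContinuum-12701` (`NetworkReduction` of route `HonestZwanzig`,
sub-problem `FouriersLaw`). For the canonical objects of the route (correlation `corr`, Laplace
transform `lap_s`, covariance `cov`, split site energies `e_x`, admissible class `Adm`, all taken
as implicit variables with their defining equations as named hypotheses) this file verifies, from
the route items `FeshbachIdentities` (package `hFI`), `GeneratorSiteEnergy` (`hGSE`) and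
`ParityStatics` (`hPS`, second clause), every hypothesis of the abstract circuit bound
`circuit_sandwich` at a fixed Laplace variable `s > 0`: symmetry of `G(s)` (`pkg_G_symm`), time
reversal on the current (`pkg_rev`), the Kolmogorov identities (`pkg_K1`–`pkg_K4`, using
`cov((L e_x)∘Θ, e_y) = cov(e_x, L e_y)` from static reversal and the symmetry of
`cov(e_x, L e_y) = −γT²[x = y ∈ ∂]`, and `cov(e_y, J) = 0`), the bond decomposition of
`(L e_y)∘Θ` (`pkg_Lr_pointwise`, `pkg_Lr_lap`), `lap_s(J, ·) = Σ_b lap_s(j_b, ·)` and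
`j_{N−1} ≡ 0`. The conclusion is `fixedN_sandwich`:
`Σ_b σ_b(s) − c⁻¹(Σ_{b+1<N}(σ_b(s) − k)² + (γτ_0(s) − k)² + (γτ_{N−1}(s) + k)²) ≤ lap_s(J,J) ≤ Σ_b σ_b(s)`
with `σ_b(s) = schur_s(j_b, J)`, `τ_y(s) = schur_s(p_y², J)`, under positive definiteness of
`Cov(e,e)`, `G(s)` and Robin coercivity of the Feshbach matrix with constant `c`.
-/

noncomputable section

open MeasureTheory Finset Real Set Filter ProbabilityTheory
open Literature.MathematicalPhysics.KineticTheory.HeatConduction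

namespace Summit.AtomisticToContinuum.FouriersLaw.Theorems.HonestZwanzig.NetworkReduction

/-! ### The fixed-`s` package: hypotheses of `circuit_sandwich` for the canonical objects -/

section Package

variable {ω₂ lam β γ : ℝ} {N : ℕ} {T : ℝ}
  {Adm : (PhaseSpace N → ℝ) → Prop}
  {corr : (PhaseSpace N → ℝ) → (PhaseSpace N → ℝ) → ℝ → ℝ}
  {lap : ℝ → (PhaseSpace N → ℝ) → (PhaseSpace N → ℝ) → ℝ}
  {cov : (PhaseSpace N → ℝ) → (PhaseSpace N → ℝ) → ℝ}
  {e : Fin N → PhaseSpace N → ℝ}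
  (hAdm : ∀ f, Adm f ↔ (Continuous f ∧ ∃ A : ℝ, ∀ z,
    |f z| ≤ A * Real.exp ((pinnedChain ω₂ lam β γ).hamiltonian N z / (8 * T))))
  (hcorr : ∀ f g t, corr f g t =
    (∫ z, f z * (∫ y, g y ∂((pinnedChain ω₂ lam β γ).transitionKernel N T T t.toNNReal z))
      ∂(pinnedChain ω₂ lam β γ).gibbsMeasure N T) -
    (∫ z, f z ∂(pinnedChain ω₂ lam β γ).gibbsMeasure N T) *
      (∫ z, g z ∂(pinnedChain ω₂ lam β γ).gibbsMeasure N T))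
  (hlap : ∀ s f g, lap s f g = ∫ t in Set.Ioi (0 : ℝ), Real.exp (-(s * t)) * corr f g t)
  (hcov : ∀ f g, cov f g = (∫ z, f z * g z ∂(pinnedChain ω₂ lam β γ).gibbsMeasure N T) -
    (∫ z, f z ∂(pinnedChain ω₂ lam β γ).gibbsMeasure N T) *
      (∫ z, g z ∂(pinnedChain ω₂ lam β γ).gibbsMeasure N T))
  (he : ∀ x z, e x z = z.2 x ^ 2 / 2 + (pinnedChain ω₂ lam β γ).U (z.1 x) +
    ∑ j : Fin N, ((if j.val = x.val + 1 then (pinnedChain ω₂ lam β γ).V (z.1 j - z.1 x) / 2 else 0) +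
      (if x.val = j.val + 1 then (pinnedChain ω₂ lam β γ).V (z.1 x - z.1 j) / 2 else 0)))
  (hFI : ∀ f g : PhaseSpace N → ℝ, Adm f → Adm g →
    Integrable f ((pinnedChain ω₂ lam β γ).gibbsMeasure N T) ∧
    (∀ t : ℝ, 0 ≤ t → Integrable (fun z => f z *
      (∫ y, g y ∂((pinnedChain ω₂ lam β γ).transitionKernel N T T t.toNNReal z)))
      ((pinnedChain ω₂ lam β γ).gibbsMeasure N T)) ∧
    IntegrableOn (corr f g) (Set.Ioi 0) ∧
    (∀ t : ℝ, 0 ≤ t → corr f g t = corr (fun z => g (z.1, -z.2)) (fun z => f (z.1, -z.2)) t) ∧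
    (∀ s : ℝ, 0 < s → ∀ x : Fin N,
      s * lap s (e x) g - cov (e x) g =
        lap s (fun z => (pinnedChain ω₂ lam β γ).generator N T T (e x) (z.1, -z.2)) g ∧
      s * lap s f (e x) - cov f (e x) = lap s f ((pinnedChain ω₂ lam β γ).generator N T T (e x))))
  (hGSE : ∀ (x : Fin N) (z : PhaseSpace N), (pinnedChain ω₂ lam β γ).generator N T T (e x) z =
    (∑ b : Fin N, ((if x.val = b.val + 1 then (pinnedChain ω₂ lam β γ).bondCurrent N b z else 0) -
      (if b = x then (pinnedChain ω₂ lam β γ).bondCurrent N b z else 0))) +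
    (if x.val = 0 then (pinnedChain ω₂ lam β γ).γ * (T - z.2 x ^ 2) else 0) +
    (if x.val = N - 1 then (pinnedChain ω₂ lam β γ).γ * (T - z.2 x ^ 2) else 0))
  (hPS : ∀ x y : Fin N, cov (e x) ((pinnedChain ω₂ lam β γ).generator N T T (e y)) =
    -(if x = y ∧ (x.val = 0 ∨ x.val = N - 1) then (pinnedChain ω₂ lam β γ).γ * T ^ 2 else 0))
  (hω : 0 < ω₂) (hl : 0 ≤ lam) (hβ : 0 ≤ β) (hγ : 0 ≤ γ) (hT : 0 < T)

include hAdm hGSE hω hl hβ hT in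
/-- `L e_x` is admissible (it is the polynomial of `GeneratorSiteEnergy`). -/
theorem adm_generator_e (x : Fin N) : Adm ((pinnedChain ω₂ lam β γ).generator N T T (e x)) := by
  refine adm_of_eq Adm (hGSE x) ?_
  refine adm_add Adm hAdm (adm_add Adm hAdm ?_ ?_) ?_
  · refine adm_sum Adm hAdm Finset.univ _ (adm_const Adm hAdm hω hl hβ hT 0) fun b _ => ?_
    exact adm_sub Adm hAdm
      (adm_ite Adm _ (adm_bondCurrent Adm hAdm hω hl hβ hT b) (adm_const Adm hAdm hω hl hβ hT 0))
      (adm_ite Adm _ (adm_bondCurrent Adm hAdm hω hl hβ hT b) (adm_const Adm hAdm hω hl hβ hT 0))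
  · exact adm_ite Adm _ (adm_const_mul Adm hAdm _ (adm_sub Adm hAdm (adm_const Adm hAdm hω hl hβ hT T)
      (adm_psq Adm hAdm hω hl hβ hT x))) (adm_const Adm hAdm hω hl hβ hT 0)
  · exact adm_ite Adm _ (adm_const_mul Adm hAdm _ (adm_sub Adm hAdm (adm_const Adm hAdm hω hl hβ hT T)
      (adm_psq Adm hAdm hω hl hβ hT x))) (adm_const Adm hAdm hω hl hβ hT 0)

include hAdm hlap hFI he hω hl hβ hT in
/-- `G(s)` is symmetric (time reversal; the site energies are even in `p`). -/
theorem pkg_G_symm (s : ℝ) (x y : Fin N) : lap s (e x) (e y) = lap s (e y) (e x) := by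
  rw [lap_rev hlap hFI (adm_e Adm hAdm e he hω hl hβ hT x) (adm_e Adm hAdm e he hω hl hβ hT y) s]
  congr 1 <;> funext z <;> exact e_neg_momentum _ e he _ z

include hAdm hcorr hlap hFI he hω hl hβ hT in
/-- `lap_s(e_x, J) = −lap_s(J, e_x)` (time reversal; the current is odd in `p`). -/
theorem pkg_rev (s : ℝ) (x : Fin N) :
    lap s (e x) (fun z => ∑ i : Fin N, (pinnedChain ω₂ lam β γ).bondCurrent N i z) =
      -lap s (fun z => ∑ i : Fin N, (pinnedChain ω₂ lam β γ).bondCurrent N i z) (e x) := by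
  rw [lap_rev hlap hFI (adm_e Adm hAdm e he hω hl hβ hT x) (adm_totalCurrent Adm hAdm hω hl hβ hT) s]
  have h1 : (fun z : PhaseSpace N => ∑ i : Fin N, (pinnedChain ω₂ lam β γ).bondCurrent N i (z.1, -z.2)) =
      fun z => (-1) * ∑ i : Fin N, (pinnedChain ω₂ lam β γ).bondCurrent N i z := by
    funext z
    rw [neg_one_mul, ← Finset.sum_neg_distrib]
    exact Finset.sum_congr rfl fun i _ => OscillatorChain.bondCurrent_neg_momentum _ N i z
  have h2 : (fun z : PhaseSpace N => e x (z.1, -z.2)) = e x := funext fun z => e_neg_momentum _ e he x z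
  rw [h1, h2, lap_const_mul_left hcorr hlap]
  ring

include hAdm hFI he hω hl hβ hT in
/-- First Kolmogorov identity against a site energy:
`lap_s((L e_x)∘Θ, e_u) = s·lap_s(e_x, e_u) − cov(e_x, e_u)`. -/
theorem pkg_K1 {s : ℝ} (hs : 0 < s) (x u : Fin N) :
    lap s (fun z => (pinnedChain ω₂ lam β γ).generator N T T (e x) (z.1, -z.2)) (e u) =
      s * lap s (e x) (e u) - cov (e x) (e u) :=
  (((hFI (e x) (e u) (adm_e Adm hAdm e he hω hl hβ hT x) (adm_e Adm hAdm e he hω hl hβ hT u)).2.2.2.2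
    s hs x).1).symm

include hAdm hFI he hω hl hβ hT in
/-- Second Kolmogorov identity against a site energy:
`lap_s(e_u, L e_y) = s·lap_s(e_u, e_y) − cov(e_u, e_y)`. -/
theorem pkg_K2 {s : ℝ} (hs : 0 < s) (u y : Fin N) :
    lap s (e u) ((pinnedChain ω₂ lam β γ).generator N T T (e y)) =
      s * lap s (e u) (e y) - cov (e u) (e y) :=
  (((hFI (e u) (e u) (adm_e Adm hAdm e he hω hl hβ hT u) (adm_e Adm hAdm e he hω hl hβ hT u)).2.2.2.2
    s hs y).2).symm

include hAdm hlap hcov hFI he hGSE hPS hω hl hβ hT in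
/-- `cov((L e_x)∘Θ, e_y) = cov(e_x, L e_y)`: static reversal plus the SYMMETRY of the matrix
`cov(e_x, L e_y) = −γT²[x = y ∈ ∂]` (`ParityStatics`). -/
theorem pkg_cov_Lr (x y : Fin N) :
    cov (fun z => (pinnedChain ω₂ lam β γ).generator N T T (e x) (z.1, -z.2)) (e y) =
      cov (e x) ((pinnedChain ω₂ lam β γ).generator N T T (e y)) := by
  have hLf := adm_generator_e hAdm hGSE hω hl hβ hT (e := e)
  have hLr : Adm (fun z => (pinnedChain ω₂ lam β γ).generator N T T (e x) (z.1, -z.2)) :=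
    adm_rev Adm hAdm (hLf x)
  have h1 := cov_e_rev hAdm hlap he hFI hω hl hβ hT hLf y hLr
  have h2 : (fun z : PhaseSpace N => (fun w : PhaseSpace N =>
      (pinnedChain ω₂ lam β γ).generator N T T (e x) (w.1, -w.2)) (z.1, -z.2)) =
      (pinnedChain ω₂ lam β γ).generator N T T (e x) := by
    funext z
    simp
  rw [h2] at h1
  rw [cov_comm hcov, h1, cov_comm hcov, hPS, hPS]
  by_cases hxy : x = y
  · subst hxy; rfl
  · rw [if_neg (fun h => hxy h.1.symm), if_neg (fun h => hxy h.1)]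

include hAdm hlap hcov hFI he hGSE hPS hω hl hβ hT in
/-- The second Kolmogorov identity between two generator observables:
`lap_s((L e_x)∘Θ, L e_y) = s(s·lap_s(e_x,e_y) − cov(e_x,e_y)) − cov(e_x, L e_y)`. -/
theorem pkg_K3 {s : ℝ} (hs : 0 < s) (x y : Fin N) :
    lap s (fun z => (pinnedChain ω₂ lam β γ).generator N T T (e x) (z.1, -z.2))
        ((pinnedChain ω₂ lam β γ).generator N T T (e y)) =
      s * (s * lap s (e x) (e y) - cov (e x) (e y)) -
        cov (e x) ((pinnedChain ω₂ lam β γ).generator N T T (e y)) := by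
  have hLf := adm_generator_e hAdm hGSE hω hl hβ hT (e := e)
  have hLr : Adm (fun z => (pinnedChain ω₂ lam β γ).generator N T T (e x) (z.1, -z.2)) :=
    adm_rev Adm hAdm (hLf x)
  have k := (((hFI _ (e y) hLr (adm_e Adm hAdm e he hω hl hβ hT y)).2.2.2.2 s hs y).2).symm
  rw [k, pkg_K1 hAdm he hFI hω hl hβ hT hs, pkg_cov_Lr hAdm hlap hcov he hFI hGSE hPS hω hl hβ hT]

include hAdm hlap hcov hFI he hGSE hω hl hβ hT in
/-- `cov(e_y, J) = 0` (static reversal; the current is odd in `p`). -/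
theorem pkg_cov_eJ (y : Fin N) :
    cov (e y) (fun z => ∑ i : Fin N, (pinnedChain ω₂ lam β γ).bondCurrent N i z) = 0 := by
  have hLf := adm_generator_e hAdm hGSE hω hl hβ hT (e := e)
  have h1 := cov_e_rev hAdm hlap he hFI hω hl hβ hT hLf y (adm_totalCurrent Adm hAdm hω hl hβ hT)
  have h2 : (fun z : PhaseSpace N => ∑ i : Fin N, (pinnedChain ω₂ lam β γ).bondCurrent N i (z.1, -z.2)) =
      fun z => (-1) * ∑ i : Fin N, (pinnedChain ω₂ lam β γ).bondCurrent N i z := by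
    funext z
    rw [neg_one_mul, ← Finset.sum_neg_distrib]
    exact Finset.sum_congr rfl fun i _ => OscillatorChain.bondCurrent_neg_momentum _ N i z
  rw [h2, cov_const_mul_left hcov, cov_comm hcov (fun z => ∑ i, _)] at h1
  linarith

include hAdm hcorr hlap hcov hFI he hGSE hω hl hβ hT in
/-- First Kolmogorov identity against the current: `lap_s((L e_y)∘Θ, J) = −s·lap_s(J, e_y)`. -/
theorem pkg_K4 {s : ℝ} (hs : 0 < s) (y : Fin N) :
    lap s (fun z => (pinnedChain ω₂ lam β γ).generator N T T (e y) (z.1, -z.2))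
        (fun z => ∑ i : Fin N, (pinnedChain ω₂ lam β γ).bondCurrent N i z) =
      -(s * lap s (fun z => ∑ i : Fin N, (pinnedChain ω₂ lam β γ).bondCurrent N i z) (e y)) := by
  have k := (((hFI (e y) _ (adm_e Adm hAdm e he hω hl hβ hT y)
    (adm_totalCurrent Adm hAdm hω hl hβ hT)).2.2.2.2 s hs y).1).symm
  rw [k, pkg_cov_eJ hAdm hlap hcov he hFI hGSE hω hl hβ hT, pkg_rev hAdm hcorr hlap he hFI hω hl hβ hT]
  ring

include hGSE in
/-- Pointwise bond decomposition of `(L e_y)∘Θ` (from `GeneratorSiteEnergy`, currents odd in `p`):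
`(L e_y)(q,−p) = Σ_b ([b = y] − [y = b+1]) j_b − γ[y ∈ ∂] p_y² + γ[y ∈ ∂] T`. -/
theorem pkg_Lr_pointwise (y : Fin N) (z : PhaseSpace N) :
    (pinnedChain ω₂ lam β γ).generator N T T (e y) (z.1, -z.2) =
      (∑ b : Fin N, ((if b = y then 1 else 0) - (if y.val = b.val + 1 then 1 else 0)) *
        (pinnedChain ω₂ lam β γ).bondCurrent N b z) +
      (-((pinnedChain ω₂ lam β γ).γ * ((if y.val = 0 then 1 else 0) + (if y.val = N - 1 then 1 else 0)))) *
        z.2 y ^ 2 +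
      (pinnedChain ω₂ lam β γ).γ * ((if y.val = 0 then 1 else 0) + (if y.val = N - 1 then 1 else 0)) * T := by
  rw [hGSE]
  simp only [OscillatorChain.bondCurrent_neg_momentum, Pi.neg_apply, neg_sq]
  have hsum : (∑ b : Fin N, ((if y.val = b.val + 1 then -(pinnedChain ω₂ lam β γ).bondCurrent N b z else 0) -
      (if b = y then -(pinnedChain ω₂ lam β γ).bondCurrent N b z else 0))) =
      ∑ b : Fin N, ((if b = y then 1 else 0) - (if y.val = b.val + 1 then 1 else 0)) *
        (pinnedChain ω₂ lam β γ).bondCurrent N b z := by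
    refine Finset.sum_congr rfl fun b _ => ?_
    split_ifs <;> ring
  rw [hsum]
  split_ifs <;> ring

include hAdm hcorr hlap hFI hGSE hω hl hβ hγ hT in
/-- Bond decomposition of `lap_s((L e_y)∘Θ, g)` for admissible `g`. -/
theorem pkg_Lr_lap {s : ℝ} (hs : 0 ≤ s) (y : Fin N) {g : PhaseSpace N → ℝ} (hg : Adm g) :
    lap s (fun z => (pinnedChain ω₂ lam β γ).generator N T T (e y) (z.1, -z.2)) g =
      (∑ b : Fin N, ((if b = y then 1 else 0) - (if y.val = b.val + 1 then 1 else 0)) *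
        lap s ((pinnedChain ω₂ lam β γ).bondCurrent N b) g) +
      (-((pinnedChain ω₂ lam β γ).γ * ((if y.val = 0 then 1 else 0) + (if y.val = N - 1 then 1 else 0)))) *
        lap s (fun z => z.2 y ^ 2) g :=
  lap_lincomb_left hAdm hcorr hlap hFI hω hl hβ hγ hT _ _ _ ((pinnedChain ω₂ lam β γ).bondCurrent N)
    (fun z => z.2 y ^ 2) _ (pkg_Lr_pointwise hGSE y) (adm_bondCurrent Adm hAdm hω hl hβ hT)
    (adm_psq Adm hAdm hω hl hβ hT y) hg hs

include hAdm hcorr hlap hFI hω hl hβ hT in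
/-- `lap_s(J, g) = Σ_b lap_s(j_b, g)` for admissible `g`. -/
theorem pkg_J_lap {s : ℝ} (hs : 0 ≤ s) {g : PhaseSpace N → ℝ} (hg : Adm g) :
    lap s (fun z => ∑ i : Fin N, (pinnedChain ω₂ lam β γ).bondCurrent N i z) g =
      ∑ b : Fin N, lap s ((pinnedChain ω₂ lam β γ).bondCurrent N b) g :=
  lap_sum_left' hAdm hcorr hlap hFI hω hl hβ hT Finset.univ ((pinnedChain ω₂ lam β γ).bondCurrent N)
    (fun b _ => adm_bondCurrent Adm hAdm hω hl hβ hT b) hg hs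

include hcorr hlap in
/-- The missing last bond carries no current: `lap_s(j_{N−1}, g) = 0`. -/
theorem pkg_j_last (s : ℝ) (b : Fin N) (hb : ¬ b.val + 1 < N) (g : PhaseSpace N → ℝ) :
    lap s ((pinnedChain ω₂ lam β γ).bondCurrent N b) g = 0 := by
  have : (pinnedChain ω₂ lam β γ).bondCurrent N b = fun _ => 0 :=
    funext fun z => bondCurrent_eq_zero_of_last _ b hb z
  rw [this, lap_zero_left hcorr hlap]

include hAdm hcorr hlap hcov hFI he hGSE hPS hω hl hβ hγ hT in
/-- **The fixed-`N`, fixed-`s` sandwich.** For `N ≥ 2`, `0 < s`, positive definite `Cov(e,e)` and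
`G(s)`, and Robin coercivity of the Feshbach matrix `𝔽_N(s)` with constant `c > 0`:
`Σ_b σ_b(s) − c⁻¹ (Σ_{b+1<N} (σ_b(s) − k)² + (γτ_0(s) − k)² + (γτ_{N−1}(s) + k)²) ≤ lap_s(J,J) ≤
Σ_b σ_b(s)` for every `k`, where `σ_b(s) = schur_s(j_b, J)` and `τ_y(s) = schur_s(p_y², J)`. -/
theorem fixedN_sandwich (hN : 2 ≤ N) {s : ℝ} (hs : 0 < s)
    (G : Matrix (Fin N) (Fin N) ℝ) (hG : ∀ x y, G x y = lap s (e x) (e y))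
    (schur : (PhaseSpace N → ℝ) → (PhaseSpace N → ℝ) → ℝ)
    (hschur : ∀ f g, schur f g = lap s f g - ∑ x, ∑ y, lap s f (e x) * G⁻¹ x y * lap s (e y) g)
    (F : Fin N → Fin N → ℝ)
    (hF : ∀ x y, F x y = s * cov (e x) (e y) - cov (e x) ((pinnedChain ω₂ lam β γ).generator N T T (e y)) -
      schur (fun z => (pinnedChain ω₂ lam β γ).generator N T T (e x) (z.1, -z.2))
        ((pinnedChain ω₂ lam β γ).generator N T T (e y)))
    (hGp : ∀ v : Fin N → ℝ, v ≠ 0 → 0 < ∑ x, ∑ y, v x * G x y * v y)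
    (hCp : ∀ v : Fin N → ℝ, v ≠ 0 → 0 < ∑ x, ∑ y, v x * cov (e x) (e y) * v y)
    {c : ℝ} (hc : 0 < c)
    (hRobin : ∀ ξ : Fin N → ℝ, c * (∑ i : Fin N, ((∑ j : Fin N,
        if j.val = i.val + 1 then (ξ j - ξ i) ^ 2 else 0) + (if i.val = 0 then ξ i ^ 2 else 0) +
        (if i.val = N - 1 then ξ i ^ 2 else 0))) ≤ ∑ x, ∑ y, ξ x * F x y * ξ y)
    (k : ℝ) :
    (∑ b, schur ((pinnedChain ω₂ lam β γ).bondCurrent N b)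
        (fun z => ∑ i : Fin N, (pinnedChain ω₂ lam β γ).bondCurrent N i z)) -
      (1 / c) * ((∑ b : Fin N, if b.val + 1 < N then (schur ((pinnedChain ω₂ lam β γ).bondCurrent N b)
        (fun z => ∑ i : Fin N, (pinnedChain ω₂ lam β γ).bondCurrent N i z) - k) ^ 2 else 0)
        + ((pinnedChain ω₂ lam β γ).γ * schur (fun z => z.2 (⟨0, by omega⟩ : Fin N) ^ 2)
            (fun z => ∑ i : Fin N, (pinnedChain ω₂ lam β γ).bondCurrent N i z) - k) ^ 2
        + ((pinnedChain ω₂ lam β γ).γ * schur (fun z => z.2 (⟨N - 1, by omega⟩ : Fin N) ^ 2)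
            (fun z => ∑ i : Fin N, (pinnedChain ω₂ lam β γ).bondCurrent N i z) + k) ^ 2)
      ≤ lap s (fun z => ∑ i : Fin N, (pinnedChain ω₂ lam β γ).bondCurrent N i z)
          (fun z => ∑ i : Fin N, (pinnedChain ω₂ lam β γ).bondCurrent N i z) ∧
    lap s (fun z => ∑ i : Fin N, (pinnedChain ω₂ lam β γ).bondCurrent N i z)
        (fun z => ∑ i : Fin N, (pinnedChain ω₂ lam β γ).bondCurrent N i z) ≤
      ∑ b, schur ((pinnedChain ω₂ lam β γ).bondCurrent N b)
        (fun z => ∑ i : Fin N, (pinnedChain ω₂ lam β γ).bondCurrent N i z) := by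
  have hJ : Adm (fun z => ∑ i : Fin N, (pinnedChain ω₂ lam β γ).bondCurrent N i z) :=
    adm_totalCurrent Adm hAdm hω hl hβ hT
  have hex : ∀ x, Adm (e x) := fun x => adm_e Adm hAdm e he hω hl hβ hT x
  exact circuit_sandwich (lap s) cov schur e ((pinnedChain ω₂ lam β γ).bondCurrent N)
    (fun y z => z.2 y ^ 2) (fun y => (pinnedChain ω₂ lam β γ).generator N T T (e y))
    (fun y z => (pinnedChain ω₂ lam β γ).generator N T T (e y) (z.1, -z.2))
    (fun z => ∑ i : Fin N, (pinnedChain ω₂ lam β γ).bondCurrent N i z)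
    G (Matrix.of fun x y => cov (e x) (e y)) F s (pinnedChain ω₂ lam β γ).γ hN hG (fun _ _ => rfl)
    hschur hF (pkg_G_symm hAdm hlap he hFI hω hl hβ hT s) hGp (fun x y => cov_comm hcov (e x) (e y)) hCp
    (pkg_rev hAdm hcorr hlap he hFI hω hl hβ hT s) (pkg_K1 hAdm he hFI hω hl hβ hT hs)
    (pkg_K2 hAdm he hFI hω hl hβ hT hs) (pkg_K3 hAdm hlap hcov he hFI hGSE hPS hω hl hβ hT hs)
    (pkg_K4 hAdm hcorr hlap hcov he hFI hGSE hω hl hβ hT hs)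
    (fun y => pkg_Lr_lap hAdm hcorr hlap hFI hGSE hω hl hβ hγ hT hs.le y hJ)
    (fun y u => pkg_Lr_lap hAdm hcorr hlap hFI hGSE hω hl hβ hγ hT hs.le y (hex u))
    (pkg_J_lap hAdm hcorr hlap hFI hω hl hβ hT hs.le hJ)
    (fun u => pkg_J_lap hAdm hcorr hlap hFI hω hl hβ hT hs.le (hex u))
    (fun b hb => ⟨pkg_j_last hcorr hlap s b hb _, fun u => pkg_j_last hcorr hlap s b hb _⟩) hc hRobin k

end Package

end Summit.AtomisticToContinuum.FouriersLaw.Theorems.HonestZwanzig.NetworkReduction
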